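import Summits.ResolutionOfSingularities.ResolutionOfSingularities.Theorems.FrobeniusLadderFRationalResolutionTraceIdealBasics
import Mathlib.Algebra.Module.FinitePresentation
import Mathlib.Algebra.Module.LocalizedModule.IsLocalization
import Mathlib.RingTheory.Localization.AtPrime.Basic
import Mathlib.RingTheory.Finiteness.Ideal
import Mathlib.RingTheory.LocalRing.MaximalIdeal.Basic
import Mathlib.RingTheory.Noetherian.Basic
import HarnessLib

/-!
# Crux `FrobeniusLadder.FRationalResolution` (stmt-ResolutionOfSingularities-15317), line `redirect`,
# stub `stub_diagonalizableQuotientResolution` — TRACE IDEALS OF LOCALLY PRINCIPAL IDEALS ARE `𝔪`-PRIMARY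
# (the slots `(𝔔'Ê)ⁿ ⊆ 𝔞_totᴺ` and `𝔞_totᴺ ≠ ⊤` of `…IntrinsicRecipe.hloc_of_traceIdealCentre_then_singularPoints`, p839630)

The class-group centre of the (S1) recipe (MEMO-15317-leafhand2-g16 §2, g17 §3 (α′)) is `𝔞_tot = ∏_{T ∈ 𝒯} T`, `𝒯` the (finite) set
of trace ideals `τ(I) = Σ_{φ : I → A} φ(I)` of the nonzero divisorial ideals `I` of the complete local domain `A = Ê`. The capstone needs
`𝔪̂ⁿ ⊆ 𝔞_totᴺ` and `𝔞_totᴺ ≠ ⊤`. Both are general commutative algebra, proved here def-free in the inline currency of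
`…TraceIdealBasics` (p839642):

* `eq_span_singleton_of_apply_eq_one` — if a functional `φ : I → A` takes the value `1` at `x₀ ∈ I` then `I = (x₀)` (any commutative
  ring: `w = w·φ(x₀) = φ(w x₀) = x₀·φ(w)`);
* ★ `exists_eq_span_singleton_of_traceIdeal_eq_top` — over a LOCAL ring, `τ(I) = A` forces `I` principal; contrapositively
  `traceIdeal_le_maximalIdeal_of_not_principal`: **non-principal ideals have `τ(I) ⊆ 𝔪`** (so `𝔞_tot ≠ ⊤` as soon as one class is
  non-principal: `prod_ne_top_of_mem`);
* ★★ `not_traceIdeal_le_of_map_eq_span_singleton` — `A` a Noetherian domain, `I ≠ 0`, `𝔮` a prime at which `I A_𝔮` is principal: `τ(I) ⊄ 𝔮`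
  (`Hom_A(I, −)` commutes with localisation for the finitely presented `I`, Mathlib `Module.FinitePresentation.exists_lift_of_isLocalizedModule`:
  a generator-detecting functional `I A_𝔮 → A_𝔮` is `φ/s` with `φ : I → A`, and `φ(I) ⊆ 𝔮` would put `1` in `𝔮A_𝔮`);
* ★★ `exists_pow_maximalIdeal_le_traceIdeal` — hence over a Noetherian LOCAL domain whose nonzero ideal `I` is principal at every
  non-maximal prime (e.g. `Spec A ∖ {𝔪}` regular, hence locally factorial, and `I` divisorial), **`𝔪ⁿ ⊆ τ(I)` for some `n`**;
  `exists_pow_le_prod` packages the finite product: `𝔪ᴺ ⊆ ∏_{T ∈ 𝒯} T`.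

Honest label: general commutative algebra toward ONE leaf stub (no stub, crux or summit closed). No definitions, no named facts, no sorry.
[folklore; cite: Matsumura1987, §11; Thm. 7.11] [cite: StacksProject, Tag 0AUU; Tag 00HP]
-/

-- single-problem summit: the doubled namespace component is forced
set_option linter.dupNamespace false

open IsLocalRing

namespace Summit.ResolutionOfSingularities.ResolutionOfSingularities.Theorems.FRationalResolution.TraceIdealPrimary

universe u

/-! ## §1 `τ(I) = A` over a local ring forces `I` principal -/

/-- **A functional with `φ(x₀) = 1` makes `I = (x₀)`**: for `w ∈ I`, `w = w·φ(x₀) = φ(w·x₀) = x₀·φ(w)`. [folklore] -/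
theorem eq_span_singleton_of_apply_eq_one {A : Type u} [CommRing A] {I : Ideal A} (φ : I →ₗ[A] A) (x₀ : I)
    (h : φ x₀ = 1) : I = Ideal.span {(x₀ : A)} := by
  apply le_antisymm
  · intro w hw
    rw [Ideal.mem_span_singleton']
    refine ⟨φ ⟨w, hw⟩, ?_⟩
    have h1 : ((w : A) • x₀ : I) = ((x₀ : A) • (⟨w, hw⟩ : I)) := by
      ext
      simp only [SetLike.val_smul, smul_eq_mul, mul_comm]
    have h2 := congrArg φ h1
    rw [map_smul, map_smul, h, smul_eq_mul, mul_one, smul_eq_mul] at h2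
    rw [mul_comm]
    exact h2.symm
  · rw [Ideal.span_singleton_le_iff_mem]
    exact x₀.2

/-- ★ **Over a local ring, `τ(I) = A` forces `I` principal.** If `Σ_φ φ(I) = A` then some `φ(x)` is a unit (the ranges cannot all
lie in `𝔪`), and `x₀ = φ(x)⁻¹ x` has `φ(x₀) = 1`. [folklore; cite: StacksProject, Tag 0AUU] -/
theorem exists_eq_span_singleton_of_traceIdeal_eq_top {A : Type u} [CommRing A] [IsLocalRing A] (I : Ideal A)
    (h : (⨆ φ : I →ₗ[A] A, LinearMap.range φ : Ideal A) = ⊤) : ∃ x₀ : A, x₀ ∈ I ∧ I = Ideal.span {x₀} := by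
  by_contra hcon
  have hcon' : ∀ x₀ ∈ I, I ≠ Ideal.span {x₀} := fun x₀ hx₀ hEq => hcon ⟨x₀, hx₀, hEq⟩
  have hle : (⨆ φ : I →ₗ[A] A, LinearMap.range φ : Ideal A) ≤ maximalIdeal A := by
    refine iSup_le fun φ => ?_
    rintro _ ⟨x, rfl⟩
    by_contra hx
    rw [IsLocalRing.mem_maximalIdeal, mem_nonunits_iff, not_not] at hx
    obtain ⟨u, hu⟩ := hx
    have hx₀ : φ ((↑u⁻¹ : A) • x) = 1 := by
      rw [map_smul, smul_eq_mul, ← hu, Units.inv_mul]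
    exact hcon' _ ((↑u⁻¹ : A) • x).2 (eq_span_singleton_of_apply_eq_one φ _ hx₀)
  rw [h, top_le_iff] at hle
  exact (maximalIdeal.isMaximal A).ne_top hle

/-- **Non-principal ideals of a local ring have `τ(I) ⊆ 𝔪`** (and `τ(I) ≠ A`). [folklore] -/
theorem traceIdeal_le_maximalIdeal_of_not_principal {A : Type u} [CommRing A] [IsLocalRing A] (I : Ideal A)
    (hI : ∀ x₀ ∈ I, I ≠ Ideal.span {x₀}) :
    (⨆ φ : I →ₗ[A] A, LinearMap.range φ : Ideal A) ≠ ⊤ ∧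
      (⨆ φ : I →ₗ[A] A, LinearMap.range φ : Ideal A) ≤ maximalIdeal A := by
  have hne : (⨆ φ : I →ₗ[A] A, LinearMap.range φ : Ideal A) ≠ ⊤ := by
    intro h
    obtain ⟨x₀, hx₀, hEq⟩ := exists_eq_span_singleton_of_traceIdeal_eq_top I h
    exact hI x₀ hx₀ hEq
  exact ⟨hne, IsLocalRing.le_maximalIdeal hne⟩

/-- A finite product of ideals one of which is proper is proper. [folklore] -/
theorem prod_ne_top_of_mem {A : Type u} [CommRing A] (𝒯 : Finset (Ideal A)) {T : Ideal A} (hT : T ∈ 𝒯)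
    (hTtop : T ≠ ⊤) : (∏ T' ∈ 𝒯, T') ≠ ⊤ := fun h =>
  hTtop (top_le_iff.mp (h ▸ (Ideal.prod_le_inf.trans (Finset.inf_le hT))))

/-! ## §2 Trace ideals avoid the primes at which `I` is principal -/

/-- ★★ **`τ(I) ⊄ 𝔮` when `I A_𝔮` is principal.** `A` a Noetherian domain, `I ≠ 0`, `𝔮` prime, `I A_𝔮 = (t)`: the trace ideal
`τ(I) = Σ_φ φ(I)` is not contained in `𝔮`. Indeed `t ≠ 0`, `(t) ≅ A_𝔮` gives an `A`-linear `g : I → A_𝔮` whose image generates `A_𝔮`;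
`I` being finitely presented, `s·g = φ/1` for some `φ : I → A`, `s ∉ 𝔮` (Hom commutes with localisation); if `φ(I) ⊆ 𝔮` then
`g(I) ⊆ 𝔮A_𝔮`, so `1 ∈ 𝔮A_𝔮`. [cite: Matsumura1987, Thm. 7.11] [folklore] -/
theorem not_traceIdeal_le_of_map_eq_span_singleton {A : Type u} [CommRing A] [IsDomain A] [IsNoetherianRing A]
    (I : Ideal A) (hI : I ≠ ⊥) (𝔮 : Ideal A) [𝔮.IsPrime] (t : Localization.AtPrime 𝔮)
    (ht : I.map (algebraMap A (Localization.AtPrime 𝔮)) = Ideal.span {t}) :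
    ¬ (⨆ φ : I →ₗ[A] A, LinearMap.range φ : Ideal A) ≤ 𝔮 := by
  intro hle
  haveI : IsDomain (Localization.AtPrime 𝔮) :=
    IsLocalization.isDomain_localization (Ideal.primeCompl_le_nonZeroDivisors 𝔮)
  have hinj : Function.Injective (algebraMap A (Localization.AtPrime 𝔮)) :=
    IsLocalization.injective (Localization.AtPrime 𝔮) (Ideal.primeCompl_le_nonZeroDivisors 𝔮)
  -- `t ≠ 0`
  have ht0 : t ≠ 0 := by
    intro ht0
    obtain ⟨x, hxI, hx0⟩ := Submodule.exists_mem_ne_zero_of_ne_bot hI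
    have hx : algebraMap A (Localization.AtPrime 𝔮) x ∈ Ideal.span {t} := by
      rw [← ht]
      exact Ideal.mem_map_of_mem _ hxI
    rw [ht0, Ideal.span_singleton_zero, Ideal.mem_bot] at hx
    exact hx0 (hinj (by rw [hx, map_zero]))
  -- `(t) ≅ A_𝔮`, `e 1 = t`
  obtain ⟨e, he1⟩ := TraceIdealBasics.exists_linearEquiv_span_singleton t (mem_nonZeroDivisors_of_ne_zero ht0)
  have hmem : ∀ x : I, algebraMap A (Localization.AtPrime 𝔮) x ∈ Ideal.span {t} := by
    intro x
    rw [← ht]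
    exact Ideal.mem_map_of_mem _ x.2
  -- the `A`-linear map `g = e⁻¹ ∘ (x ↦ x/1) : I → A_𝔮`
  let g : I →ₗ[A] Localization.AtPrime 𝔮 :=
    { toFun := fun x => e.symm ⟨algebraMap A (Localization.AtPrime 𝔮) x, hmem x⟩
      map_add' := fun x y => by
        have h1 : (⟨algebraMap A (Localization.AtPrime 𝔮) ↑(x + y), hmem (x + y)⟩ : ↥(Ideal.span {t})) =
            ⟨_, hmem x⟩ + ⟨_, hmem y⟩ := by
          ext
          simp only [Submodule.coe_add, map_add]
        rw [h1, map_add]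
      map_smul' := fun a x => by
        have h1 : (⟨algebraMap A (Localization.AtPrime 𝔮) ↑(a • x), hmem (a • x)⟩ : ↥(Ideal.span {t})) =
            algebraMap A (Localization.AtPrime 𝔮) a • ⟨_, hmem x⟩ := by
          ext
          simp only [SetLike.val_smul, smul_eq_mul, map_mul]
        rw [h1, map_smul, RingHom.id_apply, smul_eq_mul, Algebra.smul_def] }
  -- Hom commutes with localisation: `s • g = φ / 1`
  haveI : Module.FinitePresentation A I := Module.finitePresentation_of_finite A I
  obtain ⟨φ, s, hφ⟩ := Module.FinitePresentation.exists_lift_of_isLocalizedModule 𝔮.primeCompl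
    (Algebra.linearMap A (Localization.AtPrime 𝔮)) g
  -- `g(I) ⊆ 𝔮 A_𝔮`
  have hgx : ∀ x : I, g x ∈ maximalIdeal (Localization.AtPrime 𝔮) := by
    intro x
    have h1 : algebraMap A (Localization.AtPrime 𝔮) (φ x) = (s : A) • g x := by
      have := LinearMap.congr_fun hφ x
      simpa only [LinearMap.coe_comp, Function.comp_apply, Algebra.linearMap_apply, LinearMap.smul_apply,
        Submonoid.smul_def] using this
    have h2 : algebraMap A (Localization.AtPrime 𝔮) (φ x) ∈ maximalIdeal (Localization.AtPrime 𝔮) := by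
      rw [← Localization.AtPrime.map_eq_maximalIdeal]
      exact Ideal.mem_map_of_mem _ (hle (Submodule.mem_iSup_of_mem φ (LinearMap.mem_range_self φ x)))
    rw [h1, Algebra.smul_def] at h2
    exact (Ideal.unit_mul_mem_iff_mem _ (IsLocalization.map_units (Localization.AtPrime 𝔮) s)).mp h2
  -- the part of `(t)` mapped into `𝔪` by `e⁻¹` contains the image of `I`, hence `t = e 1`
  have hIN : I.map (algebraMap A (Localization.AtPrime 𝔮)) ≤
      Submodule.map (Ideal.span {t}).subtype
        (Submodule.comap (e.symm : ↥(Ideal.span {t}) →ₗ[Localization.AtPrime 𝔮] Localization.AtPrime 𝔮)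
          (maximalIdeal (Localization.AtPrime 𝔮))) := by
    rw [Ideal.map_le_iff_le_comap]
    intro x hx
    exact ⟨⟨algebraMap A (Localization.AtPrime 𝔮) x, hmem ⟨x, hx⟩⟩, hgx ⟨x, hx⟩, rfl⟩
  have ht' : t ∈ I.map (algebraMap A (Localization.AtPrime 𝔮)) := by
    rw [ht]
    exact Ideal.mem_span_singleton_self t
  obtain ⟨p, hp, hpt⟩ := hIN ht'
  have hp1 : p = e 1 := Subtype.ext (hpt.trans he1.symm)
  have h1 : (e.symm : ↥(Ideal.span {t}) →ₗ[Localization.AtPrime 𝔮] Localization.AtPrime 𝔮) p ∈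
      maximalIdeal (Localization.AtPrime 𝔮) := hp
  rw [hp1, LinearEquiv.coe_coe, LinearEquiv.symm_apply_apply] at h1
  exact (maximalIdeal.isMaximal (Localization.AtPrime 𝔮)).ne_top (Ideal.eq_top_of_isUnit_mem _ h1 isUnit_one)

/-! ## §3 `𝔪ⁿ ⊆ τ(I)` for ideals principal on the punctured spectrum -/

/-- ★★ **`τ(I)` is `𝔪`-primary (or `A`).** `A` a Noetherian local domain, `I ≠ 0` principal at every prime `𝔮 ≠ 𝔪` (e.g. `I` divisorial and
`Spec A ∖ {𝔪}` regular): `𝔪ⁿ ⊆ τ(I)` for some `n` — every prime containing `τ(I)` is `𝔪` by `not_traceIdeal_le_of_map_eq_span_singleton`.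
[cite: Matsumura1987, §11; Thm. 7.11] [cite: StacksProject, Tag 00HP] [folklore] -/
theorem exists_pow_maximalIdeal_le_traceIdeal {A : Type u} [CommRing A] [IsDomain A] [IsNoetherianRing A] [IsLocalRing A]
    (I : Ideal A) (hI : I ≠ ⊥)
    (hprin : ∀ (𝔮 : Ideal A) [𝔮.IsPrime], 𝔮 ≠ maximalIdeal A →
      ∃ t : Localization.AtPrime 𝔮, I.map (algebraMap A (Localization.AtPrime 𝔮)) = Ideal.span {t}) :
    ∃ n : ℕ, maximalIdeal A ^ n ≤ (⨆ φ : I →ₗ[A] A, LinearMap.range φ : Ideal A) := by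
  refine Ideal.exists_pow_le_of_le_radical_of_fg ?_ (IsNoetherian.noetherian _)
  rw [Ideal.radical_eq_sInf]
  refine le_sInf ?_
  rintro 𝔮 ⟨h𝔮τ, h𝔮⟩
  by_cases h : 𝔮 = maximalIdeal A
  · exact h ▸ le_rfl
  · obtain ⟨t, ht⟩ := hprin 𝔮 h
    exact absurd h𝔮τ (not_traceIdeal_le_of_map_eq_span_singleton I hI 𝔮 t ht)

/-- **A finite product of ideals each containing a power of `𝔪` contains a power of `𝔪`.** [folklore] -/
theorem exists_pow_le_prod {A : Type u} [CommRing A] (𝔪 : Ideal A) (𝒯 : Finset (Ideal A))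
    (h : ∀ T ∈ 𝒯, ∃ n : ℕ, 𝔪 ^ n ≤ T) : ∃ N : ℕ, 𝔪 ^ N ≤ ∏ T ∈ 𝒯, T := by
  classical
  induction 𝒯 using Finset.induction_on with
  | empty => exact ⟨0, by simp⟩
  | insert T 𝒯 hT ih =>
    obtain ⟨n, hn⟩ := h T (Finset.mem_insert_self T 𝒯)
    obtain ⟨N, hN⟩ := ih fun T' hT' => h T' (Finset.mem_insert_of_mem hT')
    refine ⟨n + N, ?_⟩
    rw [Finset.prod_insert hT, pow_add]
    exact Ideal.mul_mono hn hN

/-- ★★ **The class-group-centre slots, assembled**: `A` a Noetherian local domain and `S` a finite family of nonzero ideals, each principal at every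
non-maximal prime; then `𝔪ᴺ ⊆ ∏_{T ∈ τ(S)} T` for some `N`, where `τ(S)` is the finite set of their trace ideals (the `hfin`/product currency of
`…TraceIdealRepresentatives`, p839695). [cite: Matsumura1987, §11] [folklore] -/
theorem exists_pow_maximalIdeal_le_prod_traceIdeal {A : Type u} [CommRing A] [IsDomain A] [IsNoetherianRing A] [IsLocalRing A]
    (S : Finset (Ideal A)) (hS : ∀ I ∈ S, I ≠ ⊥)
    (hprin : ∀ I ∈ S, ∀ (𝔮 : Ideal A) [𝔮.IsPrime], 𝔮 ≠ maximalIdeal A →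
      ∃ t : Localization.AtPrime 𝔮, I.map (algebraMap A (Localization.AtPrime 𝔮)) = Ideal.span {t}) :
    ∃ N : ℕ, maximalIdeal A ^ N ≤
      ∏ T ∈ S.image (fun I : Ideal A => (⨆ φ : I →ₗ[A] A, LinearMap.range φ : Ideal A)), T := by
  classical
  refine exists_pow_le_prod (maximalIdeal A) _ fun T hT => ?_
  obtain ⟨I, hI, rfl⟩ := Finset.mem_image.mp hT
  exact exists_pow_maximalIdeal_le_traceIdeal I (hS I hI) (fun 𝔮 _ h𝔮 => hprin I hI 𝔮 h𝔮)

end Summit.ResolutionOfSingularities.ResolutionOfSingularities.Theorems.FRationalResolution.TraceIdealPrimary
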